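import Summits.BirchSwinnertonDyer.BirchSwinnertonDyer.Theorems.ThetaPartnerAtTwoSignedKatoUpToAtTwoOmegaDivisionCharValues
import HarnessLib

/-!
# Route `ThetaPartnerAtTwo` (TP2), crux K3 `SignedKatoDivisibilityUpToAtTwo` (item stmt-BirchSwinnertonDyer-20308) /
# K3P′ (stmt-BirchSwinnertonDyer-25631), line `colemanrat` v11 — the ALGEBRA of Kobayashi's Prop. 8.25:
# «`χ(P_{n,x}(z)) = (∑_σ χ(σ) log x^σ) · (∑_σ χ(σ)⁻¹ exp*(z^σ))` once the pairing is a TRACE FORM»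

Width seat `bsd-wall-tp2-p2x-w3` g6 (cell `bsd-wall`). HONEST FRAMING: theorems only (no definition, no named fact, no instance,
no `sorry`); finite-sum algebra over a commutative ring; nothing about any curve is ASSUMED true — the trace-form shape is a
HYPOTHESIS; closes no item; K3 / K3P′ are NOT settled and BSD is NOT proved by any of this.

## Why this file

The character-value socket CORE_χ (`…CoreOfCharValues.lean`, `CoreChi.core_fin_of_coreChi`) asks, character by character, for
`χ(P_{n,d_n}(z)) = ∑_{j<2ⁿ} ⟨z, gʲ d_n⟩ χ(γ)ʲ` (`tsum_coeff_pairingSum_mul_pow_eq_sum`). In print this value is computed by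
Kobayashi 2003, Prop. 8.25: with the cup-product/local Tate pairing written as a TRACE FORM through the Bloch–Kato explicit
reciprocity law (8.29) «`(x, z)_n = Tr_{k_n/ℚ_p}(log_Ê(x) · exp*_ω(z))`» (Kato, LNM 1553, II Lemma 1.4.3–1.4.4; the tree's (R1) of
`Cruxes/…/W3G5-CORE-SOCKET.md` §3), and `log`, `exp*` Galois-equivariant, one gets in `k_n[G_n]`
«`P_{n,x}(z) = (∑_σ log(x^σ) σ) · (∑_σ exp*(z^σ) σ⁻¹)`», hence at a character `χ` of `G_n`:
`χ(P_{n,x}(z)) = (∑_k χ(γ)^k gᵏ(log x)) · (∑_i χ(γ)^{−i} gⁱ(exp* z))` — a "log Gauss sum" (Kobayashi Prop. 8.26 / (R3)) times an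
"`exp*` character sum" (Kato Thm. 12.5 (1) / (R2)). This file proves exactly that FINITE-FOURIER step, abstractly:

* §1 `sum_traceForm_mul_pow_eq` (any commutative ring `R`, `N ≥ 1`, `ζ^N = 1`, sequences `a b : ℤ/N → R`):
  `∑_j (∑_i a_i b_{i+j}) ζ^j = (∑_k b_k ζ^k) · (∑_i a_i ζ^{−i})` — the trace form `j ↦ ∑_i gⁱ(e · gʲ l) = ∑_i a_i b_{i+j}`
  (`a_i = gⁱ e`, `b_k = gᵏ l`, `g^N` fixing `l`) has character value = product of the two character sums.
* §2 `sum_range_mul_pow_eq_of_traceForm`: the same with the `j`-sum over `Finset.range (p^n)` and an `ℕ`-indexed sequence `c`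
  (`c j = ∑_i a_i b_{i+j}`), i.e. literally the right-hand side of `tsum_coeff_pairingSum_mul_pow_eq_sum` for
  `c j = ι(z(gʲ • x))`: **if the functional `z = ⟨loc s_n, ·⟩` is a trace form on the orbit of `x = d_n`, then
  `χ(P_{n,d_n}(z)) = (log sum) · (exp* sum)`**. What remains PUB for CORE_χ after this is therefore: (R1) the trace-form identity for
  THE pairing `pair` (Bloch–Kato / Kato II 1.4.3 at the layers `ℚ_{2,n}`), (R2) Kato's `exp*` character sums (Thm. 12.5 (1) / 6.6 + 9.7,
  tree fact `Kato2004.exists_eulerSystem_expStar_values` with `exp*` pinned), (R3) the `log` character sums of the plus Honda points at `2`.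

References: [Kobayashi2003] (8.23), Prop. 8.25, Prop. 8.26, (8.29) (pp. 18–20); [Kato1993LNM1553] Ch. II Lemma 1.4.3–1.4.4;
[Kato2004Asterisque] Thm. 12.5 (1) (pp. 221–222); [Sprung2012] Def. 3.1 (p. 1489).
-/

set_option autoImplicit false
-- the Theorems namespace of this sub repeats the summit name by design (D-0017 nested layout)
set_option linter.dupNamespace false

noncomputable section

open scoped Classical

namespace Summit.BirchSwinnertonDyer.BirchSwinnertonDyer.Theorems.SignedKatoOffTwo.CoreChi

/-! ## §1 The finite Fourier transform of a trace form factors (any commutative ring) -/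

section TraceForm

variable {R : Type*} [CommRing R] {N : ℕ} [NeZero N]

/-- `ζ^{(i+j) mod N} = ζ^{i} ζ^{j}`-bookkeeping: for `ζ^N = 1`, `k ↦ ζ^{k.val}` is multiplicative on `ℤ/N`. [folklore] -/
theorem pow_val_add_eq_mul {ζ : R} (hζ : ζ ^ N = 1) (i j : ZMod N) :
    ζ ^ (i + j).val = ζ ^ i.val * ζ ^ j.val := by
  have hmod : ∀ m : ℕ, ζ ^ (m % N) = ζ ^ m := fun m ↦ by
    conv_rhs => rw [← Nat.div_add_mod m N, pow_add, pow_mul, hζ, one_pow, one_mul]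
  rw [ZMod.val_add, hmod, pow_add]

/-- For `ζ^N = 1`: `ζ^{(j + i).val} · ζ^{(−i).val} = ζ^{j.val}` (`ζ^{−i}` undoes `ζ^{i}`). [folklore] -/
theorem pow_val_add_mul_pow_val_neg {ζ : R} (hζ : ζ ^ N = 1) (i j : ZMod N) :
    ζ ^ (j + i).val * ζ ^ (-i).val = ζ ^ j.val := by
  rw [← pow_val_add_eq_mul hζ, add_neg_cancel_right]

/-- **The finite Fourier transform of a trace form factors** (the algebra of Kobayashi 2003, Prop. 8.25): for a commutative ring `R`,
`N ≥ 1`, `ζ ∈ R` with `ζ^N = 1` and `a, b : ℤ/N → R`,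
`∑_{j ∈ ℤ/N} (∑_{i ∈ ℤ/N} a_i · b_{i+j}) · ζ^j = (∑_k b_k ζ^k) · (∑_i a_i ζ^{−i})`
(exponents read through `ZMod.val`; `ζ^{−i} := ζ^{(−i).val}`). In the application `a_i = gⁱ(exp*_ω z)`, `b_k = gᵏ(log_Ê x)`,
`∑_i a_i b_{i+j} = ∑_i gⁱ(exp*(z)·gʲ(log x)) = Tr_{k_n/ℚ_p}(exp*(z) log(x^{gʲ})) = (x^{gʲ}, z)_n` by the explicit reciprocity law, and
`ζ = χ(γ)`: then the left side is `χ(P_{n,x}(z))` and the right side is `(∑_σ χ(σ) log x^σ)(∑_σ χ(σ)⁻¹ exp* z^σ)`.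
[cite: Kobayashi2003, Prop. 8.25 (p. 19)] -/
theorem sum_traceForm_mul_pow_eq (a b : ZMod N → R) {ζ : R} (hζ : ζ ^ N = 1) :
    ∑ j : ZMod N, (∑ i : ZMod N, a i * b (i + j)) * ζ ^ j.val =
      (∑ k : ZMod N, b k * ζ ^ k.val) * ∑ i : ZMod N, a i * ζ ^ (-i).val := by
  calc ∑ j : ZMod N, (∑ i : ZMod N, a i * b (i + j)) * ζ ^ j.val
      = ∑ j : ZMod N, ∑ i : ZMod N, a i * b (i + j) * ζ ^ j.val := by
        refine Finset.sum_congr rfl fun j _ ↦ ?_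
        rw [Finset.sum_mul]
    _ = ∑ i : ZMod N, ∑ j : ZMod N, a i * b (i + j) * ζ ^ j.val := Finset.sum_comm
    _ = ∑ i : ZMod N, ∑ k : ZMod N, a i * b k * (ζ ^ k.val * ζ ^ (-i).val) := by
        refine Finset.sum_congr rfl fun i _ ↦ ?_
        refine Fintype.sum_equiv (Equiv.addRight i) _ _ fun j ↦ ?_
        rw [Equiv.coe_addRight, add_comm i j, pow_val_add_mul_pow_val_neg hζ]
    _ = ∑ i : ZMod N, (a i * ζ ^ (-i).val) * ∑ k : ZMod N, b k * ζ ^ k.val := by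
        refine Finset.sum_congr rfl fun i _ ↦ ?_
        rw [Finset.mul_sum]
        refine Finset.sum_congr rfl fun k _ ↦ ?_
        ring
    _ = (∑ k : ZMod N, b k * ζ ^ k.val) * ∑ i : ZMod N, a i * ζ ^ (-i).val := by
        rw [← Finset.sum_mul, mul_comm]

end TraceForm

/-! ## §2 The same over `Finset.range (pⁿ)`: the character value of `P_{n,x}(z)` for a trace-form functional -/

section Range

variable {R : Type*} [CommRing R] {p : ℕ} [hp : Fact p.Prime]

/-- A sum over `Finset.range (pⁿ)` is a sum over `ℤ/pⁿ` through `ZMod.val`. [folklore] -/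
theorem sum_range_eq_sum_zmod (n : ℕ) (F : ℕ → R) :
    ∑ j ∈ Finset.range (p ^ n), F j = ∑ j : ZMod (p ^ n), F j.val := by
  haveI : NeZero (p ^ n) := ⟨pow_ne_zero _ hp.out.ne_zero⟩
  refine Finset.sum_nbij' (fun j ↦ (j : ZMod (p ^ n))) (fun j ↦ j.val) (fun j _ ↦ Finset.mem_univ _)
    (fun j _ ↦ Finset.mem_range.mpr (ZMod.val_lt j)) (fun j hj ↦ ?_) (fun j _ ↦ ZMod.natCast_zmod_val j) (fun j hj ↦ ?_)
  · exact ZMod.val_cast_of_lt (Finset.mem_range.mp hj)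
  · rw [ZMod.val_cast_of_lt (Finset.mem_range.mp hj)]

/-- **`χ(P_{n,x}(z)) = (log sum) · (exp* sum)` for a TRACE-FORM functional** — the range-indexed form consumed with
`tsum_coeff_pairingSum_mul_pow_eq_sum`: if `c : ℕ → R` satisfies `c j = ∑_{i ∈ ℤ/pⁿ} a_i · b_{i+j}` for all `j` (for
`c j = ι(z(gʲ • x))`: «`z` is the trace form `Q ↦ Tr(e · L Q)` with `L(gʲ x) = gʲ l`, `a_i = gⁱ e`, `b_k = gᵏ l`» — the Bloch–Kato
explicit reciprocity law (8.29) plus equivariance, HYPOTHESIS here), then for every `ζ ∈ R` with `ζ^{pⁿ} = 1`: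
`∑_{j<pⁿ} c_j ζ^j = (∑_k b_k ζ^k) · (∑_i a_i ζ^{−i})` (Kobayashi 2003, Prop. 8.25: `P_{n,x}(z) = (∑_σ log x^σ σ)(∑_σ exp* z^σ σ⁻¹)`,
read at the character `γ ↦ ζ`). [cite: Kobayashi2003, Prop. 8.25 (p. 19)] [cite: Sprung2012, Def. 3.1 (p. 1489)] -/
theorem sum_range_mul_pow_eq_of_traceForm (n : ℕ) (c : ℕ → R) (a b : ZMod (p ^ n) → R) {ζ : R} (hζ : ζ ^ p ^ n = 1)
    (hc : ∀ j : ℕ, c j = ∑ i : ZMod (p ^ n), a i * b (i + j)) :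
    ∑ j ∈ Finset.range (p ^ n), c j * ζ ^ j =
      (∑ k : ZMod (p ^ n), b k * ζ ^ k.val) * ∑ i : ZMod (p ^ n), a i * ζ ^ (-i).val := by
  haveI : NeZero (p ^ n) := ⟨pow_ne_zero _ hp.out.ne_zero⟩
  rw [sum_range_eq_sum_zmod n (fun j ↦ c j * ζ ^ j), ← sum_traceForm_mul_pow_eq a b hζ]
  refine Finset.sum_congr rfl fun j _ ↦ ?_
  rw [hc, ZMod.natCast_zmod_val]

end Range

end Summit.BirchSwinnertonDyer.BirchSwinnertonDyer.Theorems.SignedKatoOffTwo.CoreChi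

end
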